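import Summits.Ventures.CertifiedArithmetic.LowPrec.SRTreeCertificates
import Summits.Ventures.CertifiedArithmetic.LowPrec.SRHoeffdingFormats
import HarnessLib

/-!
# Stochastic rounding into a finite format, VII: any-order exponential (Azuma–Hoeffding) tails

HONEST FRAMING: certified error envelopes and provably optimal rounding/accumulation schemes for
low-precision formats under stated cost models; every table by two implementations; no hardware or
vendor claims.

The exponential envelope of `SRHoeffding` (recursive summation) for EVERY summation tree
(`SRTree`): along the outcome tree of a summation tree `T` with `m = T.nodes` roundings, the node
errors form a bounded martingale-difference field (each node's SR is fresh given the values of its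
two subtrees), so Hoeffding's lemma applied conditionally at every node gives, over `ℝ`,

* `treeExp_exp_le`: `NoSatT ∧ GapLET G ⇒ E[e^{t(ŝ_T − ∑ leaves)}] ≤ e^{m t² G²/8}` for every real `t`;
* `tree_prob_dev_ge_le_exp`: `P(|ŝ_T − ∑ leaves| ≥ t) ≤ 2 e^{−2t²/(m G²)}` (`t > 0`), and the
  λ-form `tree_prob_dev_ge_lambda_le`: deviation `≥ λ (G/2) √m` has probability `≤ 2e^{−λ²/2}` —
  the finite-format, absolute-error, ANY-ORDER form of [ConnollyHighamMary2021, Thm 4.6]: the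
  constant depends on the number of roundings `m = n − 1` only, not on the shape/height of the tree;
* the cast `ℚ → ℝ` commutes with the whole tree semantics (`treeExp_cast`, `noSatT_cast`,
  `gapLET_cast`), so the format instances are stated for the `ℚ` literals of the certificate files:
  E2M1 leaves `2e^{−t²/(2m)}`, and for all leaves E3M2 `2e^{−t²/(8m)}`, E2M3 `2e^{−8t²/m}`,
  E4M3 `2e^{−t²/(512m)}`, E5M2 `2e^{−t²/(2²⁵m)}` (each under `NoSatT` only).

No independence is assumed between node errors (they are dependent); what is used is the martingale
structure that the model `treeExp` has by construction (fresh random bits per rounding), exactly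
as in the sequential case.
-/

namespace Summit.Ventures.CertifiedArithmetic.LowPrec.SR

open Literature.ComputerArithmetic.ConnollyHighamMary2021 Finset Real STree

/-! ### The moment generating function along a summation tree (over `ℝ`) -/

/-- One node, shifted: if `c` is in the hull and its candidate gap is `≤ G`, then for every `e`,
`E[e^{t(SR(c) − e)}] ≤ e^{t(c − e)} · e^{t²G²/8}`. -/
theorem step_exp_shift_le (F : Finset ℝ) {c : ℝ} (hc : InHull F c) (t e : ℝ) {G : ℝ}
    (hg : roundUp F (clamp F c) - roundDown F (clamp F c) ≤ G) :
    step F c (fun v => exp (t * (v - e))) ≤ exp (t * (c - e)) * exp (t ^ 2 * G ^ 2 / 8) := by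
  have hcl : clamp F c = c := clamp_eq_self hc
  have hf : (fun v => exp (t * (v - e)))
      = fun v => exp (t * (c - e)) * exp (t * (v - clamp F c)) := by
    funext v; rw [← exp_add, hcl]; ring_nf
  rw [hf, step_mul_left]
  exact mul_le_mul_of_nonneg_left (step_exp_le F c t hg) (exp_pos _).le

/-- **The tree mgf bound.** Under `NoSatT ∧ GapLET G`, for every real `t`,
`E[e^{t(ŝ_T − ∑ leaves)}] ≤ e^{m t² G²/8}`, `m = T.nodes`: Hoeffding's lemma conditionally at every
node, inner subtree first. -/
theorem treeExp_exp_le (F : Finset ℝ) (G t : ℝ) : ∀ T : STree ℝ, NoSatT F T → GapLET F G T →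
    treeExp F T (fun v => exp (t * (v - T.exact))) ≤ exp (T.nodes * (t ^ 2 * G ^ 2 / 8))
  | .leaf x, _, _ => by simp [treeExp, STree.exact, STree.nodes]
  | .node l r, ⟨hl, hr, hh⟩, ⟨hgl, hgr, hg⟩ => by
      simp only [treeExp, STree.exact, STree.nodes]
      have ihl := treeExp_exp_le F G t l hl hgl
      have ihr := treeExp_exp_le F G t r hr hgr
      set B1 := exp (t ^ 2 * G ^ 2 / 8) with hB1
      set Br := exp ((r.nodes : ℝ) * (t ^ 2 * G ^ 2 / 8)) with hBr
      set Bl := exp ((l.nodes : ℝ) * (t ^ 2 * G ^ 2 / 8)) with hBl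
      -- (1) Hoeffding at the root, for every pair of subtree outcomes `(a, b)`
      have hA : treeExp F l (fun a => treeExp F r (fun b =>
            step F (a + b) (fun v => exp (t * (v - (l.exact + r.exact))))))
          ≤ treeExp F l (fun a => treeExp F r (fun b =>
            exp (t * (a - l.exact)) * (B1 * exp (t * (b - r.exact))))) := by
        refine treeExp_mono_of_allOut F l (allOut_mono F l (fun a ha => ?_) (allOut_and F l hh hg))
        refine treeExp_mono_of_allOut F r
          (allOut_mono F r (fun b hb => ?_) (allOut_and F r ha.1 ha.2))
        refine (step_exp_shift_le F hb.1 t _ hb.2).trans (le_of_eq ?_)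
        rw [show t * (a + b - (l.exact + r.exact)) = t * (a - l.exact) + t * (b - r.exact) by ring,
          exp_add]
        ring
      -- (2) the right subtree's mgf, for every value `a` of the left subtree
      have hB : ∀ a, treeExp F r (fun b => exp (t * (a - l.exact)) * (B1 * exp (t * (b - r.exact))))
          ≤ (B1 * Br) * exp (t * (a - l.exact)) := by
        intro a
        rw [treeExp_mul_left, treeExp_mul_left]
        have h0 : 0 ≤ exp (t * (a - l.exact)) := (exp_pos _).le
        have h1 : 0 ≤ B1 := (exp_pos _).le
        calc exp (t * (a - l.exact)) * (B1 * treeExp F r (fun b => exp (t * (b - r.exact))))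
            ≤ exp (t * (a - l.exact)) * (B1 * Br) := by gcongr
          _ = (B1 * Br) * exp (t * (a - l.exact)) := by ring
      -- (3) the left subtree's mgf
      calc treeExp F l (fun a => treeExp F r (fun b =>
              step F (a + b) (fun v => exp (t * (v - (l.exact + r.exact))))))
          ≤ treeExp F l (fun a => treeExp F r (fun b =>
              exp (t * (a - l.exact)) * (B1 * exp (t * (b - r.exact))))) := hA
        _ ≤ treeExp F l (fun a => (B1 * Br) * exp (t * (a - l.exact))) := treeExp_mono F l hB
        _ = (B1 * Br) * treeExp F l (fun a => exp (t * (a - l.exact))) := treeExp_mul_left F l _ _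
        _ ≤ (B1 * Br) * Bl := mul_le_mul_of_nonneg_left ihl (by positivity)
        _ = exp (((l.nodes + r.nodes + 1 : ℕ) : ℝ) * (t ^ 2 * G ^ 2 / 8)) := by
            rw [hB1, hBr, hBl, ← exp_add, ← exp_add]; push_cast; ring_nf

/-! ### Exponential tails (over `ℝ`) -/

/-- One-sided tails: under `NoSatT ∧ GapLET G`, for every `θ ≥ 0`,
`P(ŝ_T − ∑ ≥ t) ≤ e^{−θt} e^{mθ²G²/8}` and the same for the lower tail. -/
theorem tree_prob_updev_le (F : Finset ℝ) (G : ℝ) (T : STree ℝ) (h : NoSatT F T)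
    (hg : GapLET F G T) (t : ℝ) {θ : ℝ} (hθ : 0 ≤ θ) :
    treeExp F T (upDevInd t T.exact) ≤ exp (-(θ * t)) * exp (T.nodes * (θ ^ 2 * G ^ 2 / 8)) ∧
      treeExp F T (dnDevInd t T.exact) ≤ exp (-(θ * t)) * exp (T.nodes * (θ ^ 2 * G ^ 2 / 8)) := by
  constructor
  · calc treeExp F T (upDevInd t T.exact)
        ≤ treeExp F T (fun v => exp (-(θ * t)) * exp (θ * (v - T.exact))) :=
          treeExp_mono F T (fun v => upDevInd_le_exp t _ v hθ)
      _ ≤ exp (-(θ * t)) * exp (T.nodes * (θ ^ 2 * G ^ 2 / 8)) := by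
          rw [treeExp_mul_left]
          exact mul_le_mul_of_nonneg_left (treeExp_exp_le F G θ T h hg) (exp_pos _).le
  · calc treeExp F T (dnDevInd t T.exact)
        ≤ treeExp F T (fun v => exp (-(θ * t)) * exp (-θ * (v - T.exact))) :=
          treeExp_mono F T (fun v => dnDevInd_le_exp t _ v hθ)
      _ ≤ exp (-(θ * t)) * exp (T.nodes * (θ ^ 2 * G ^ 2 / 8)) := by
          rw [treeExp_mul_left]
          refine mul_le_mul_of_nonneg_left ?_ (exp_pos _).le
          have := treeExp_exp_le F G (-θ) T h hg
          rwa [neg_sq] at this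

/-- **Exponential envelope for SR summation in ANY order.** If no node saturates and every node's
candidate gap is `≤ G`, then for every `t > 0`, `P(|ŝ_T − ∑ leaves| ≥ t) ≤ 2 exp(−2t²/(m G²))`,
`m = T.nodes` (for `m G² = 0` the right-hand side is `2`). -/
theorem tree_prob_dev_ge_le_exp (F : Finset ℝ) (G : ℝ) (T : STree ℝ) (h : NoSatT F T)
    (hg : GapLET F G T) (t : ℝ) (ht : 0 < t) :
    treeExp F T (devInd t T.exact) ≤ 2 * exp (-2 * t ^ 2 / (T.nodes * G ^ 2)) := by
  have hsplit : treeExp F T (devInd t T.exact)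
      ≤ treeExp F T (upDevInd t T.exact) + treeExp F T (dnDevInd t T.exact) := by
    rw [← treeExp_add]; exact treeExp_mono F T (fun v => devInd_le_up_add_dn t _ v)
  by_cases hD : (T.nodes : ℝ) * G ^ 2 = 0
  · have h1 := tree_prob_updev_le F G T h hg t le_rfl
    simp only [zero_mul, neg_zero, exp_zero, one_mul, ne_eq, zero_pow, OfNat.ofNat_ne_zero,
      not_false_eq_true, zero_div, mul_zero] at h1
    rw [hD, div_zero, exp_zero, mul_one]
    linarith [h1.1, h1.2]
  · have hpos : 0 < (T.nodes : ℝ) * G ^ 2 := lt_of_le_of_ne (by positivity) (Ne.symm hD)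
    set θ := 4 * t / (T.nodes * G ^ 2) with hθ
    have hθ0 : 0 ≤ θ := by positivity
    have h1 := tree_prob_updev_le F G T h hg t hθ0
    have key : exp (-(θ * t)) * exp (T.nodes * (θ ^ 2 * G ^ 2 / 8))
        = exp (-2 * t ^ 2 / (T.nodes * G ^ 2)) := by
      rw [← exp_add]; congr 1
      rw [hθ]; field_simp; ring
    rw [key] at h1
    linarith [h1.1, h1.2]

/-- The **λ-form, any order**: deviation at least `λ (G/2) √m` has probability at most
`2 e^{−λ²/2}` (`0 < λ`, `0 < G`, `0 < m`). -/
theorem tree_prob_dev_ge_lambda_le (F : Finset ℝ) {G : ℝ} (hG : 0 < G) (T : STree ℝ)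
    (hm : 0 < T.nodes) (h : NoSatT F T) (hg : GapLET F G T) {lam : ℝ} (hlam : 0 < lam) :
    treeExp F T (devInd (lam * (G / 2) * Real.sqrt T.nodes) T.exact) ≤ 2 * exp (-lam ^ 2 / 2) := by
  have hn' : (0 : ℝ) < T.nodes := by exact_mod_cast hm
  have ht : 0 < lam * (G / 2) * Real.sqrt T.nodes := by positivity
  refine (tree_prob_dev_ge_le_exp F G T h hg _ ht).trans (le_of_eq ?_)
  have hs : Real.sqrt (T.nodes : ℝ) ^ 2 = T.nodes := Real.sq_sqrt hn'.le
  have : -2 * (lam * (G / 2) * Real.sqrt T.nodes) ^ 2 / (T.nodes * G ^ 2) = -lam ^ 2 / 2 := by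
    rw [mul_pow, mul_pow, hs]; field_simp
  rw [this]

/-! ### The cast `ℚ → ℝ` commutes with the tree semantics -/

/-- The number of roundings is unchanged by relabelling the leaves. -/
theorem nodes_map {K L : Type*} (φ : K → L) : ∀ T : STree K, (T.map φ).nodes = T.nodes
  | .leaf _ => rfl
  | .node l r => by simp only [STree.map, STree.nodes, nodes_map φ l, nodes_map φ r]

/-- The exact sum commutes with the cast. -/
theorem exact_map_cast : ∀ T : STree ℚ,
    (T.map ((↑) : ℚ → ℝ)).exact = ((T.exact : ℚ) : ℝ)
  | .leaf _ => rfl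
  | .node l r => by
      simp only [STree.map, STree.exact]; rw [exact_map_cast l, exact_map_cast r, Rat.cast_add]

/-- The tree expectation commutes with the cast (for observables that do). -/
theorem treeExp_cast (F : Finset ℚ) : ∀ (T : STree ℚ) {f : ℚ → ℚ} {g : ℝ → ℝ},
    (∀ v : ℚ, g (v : ℝ) = ((f v : ℚ) : ℝ)) →
      treeExp (realImage F) (T.map ((↑) : ℚ → ℝ)) g = ((treeExp F T f : ℚ) : ℝ)
  | .leaf x, _, _, hfg => by simp only [STree.map, treeExp]; exact hfg x
  | .node l r, f, _, hfg => by
      simp only [STree.map, treeExp]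
      refine treeExp_cast F l (f := fun a => treeExp F r (fun b => step F (a + b) f)) (fun a => ?_)
      refine treeExp_cast F r (f := fun b => step F (a + b) f) (fun b => ?_)
      rw [← Rat.cast_add]; exact step_cast F (a + b) hfg

/-- `AllOut` commutes with the cast. -/
theorem allOut_cast (F : Finset ℚ) : ∀ (T : STree ℚ) {P : ℝ → Prop},
    AllOut (realImage F) (T.map ((↑) : ℚ → ℝ)) P ↔ AllOut F T (fun v => P (v : ℝ))
  | .leaf _, _ => Iff.rfl
  | .node l r, _ => by
      simp only [STree.map, AllOut]
      rw [allOut_cast F l]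
      refine allOut_congr F l (fun a => ?_)
      rw [allOut_cast F r]
      refine allOut_congr F r (fun b => ?_)
      rw [← Rat.cast_add, up_cast, dn_cast]

/-- `NoSatT` commutes with the cast. -/
theorem noSatT_cast (F : Finset ℚ) : ∀ T : STree ℚ,
    NoSatT (realImage F) (T.map ((↑) : ℚ → ℝ)) ↔ NoSatT F T
  | .leaf _ => Iff.rfl
  | .node l r => by
      simp only [STree.map, NoSatT]
      rw [noSatT_cast F l, noSatT_cast F r, allOut_cast F l]
      refine and_congr_right' (and_congr_right' (allOut_congr F l (fun a => ?_)))
      rw [allOut_cast F r]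
      exact allOut_congr F r (fun b => by rw [← Rat.cast_add, inHull_cast])

/-- `GapLET` commutes with the cast. -/
theorem gapLET_cast (F : Finset ℚ) (G : ℚ) : ∀ T : STree ℚ,
    GapLET (realImage F) (G : ℝ) (T.map ((↑) : ℚ → ℝ)) ↔ GapLET F G T
  | .leaf _ => Iff.rfl
  | .node l r => by
      simp only [STree.map, GapLET]
      rw [gapLET_cast F G l, gapLET_cast F G r, allOut_cast F l]
      refine and_congr_right' (and_congr_right' (allOut_congr F l (fun a => ?_)))
      rw [allOut_cast F r]
      exact allOut_congr F r (fun b => by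
        rw [← Rat.cast_add, clamp_cast, roundUp_cast, roundDown_cast, ← Rat.cast_sub, Rat.cast_le])

/-- **Exponential envelope, any order, stated over `ℚ`.** -/
theorem tree_prob_dev_ge_le_exp_rat (F : Finset ℚ) (G : ℚ) (T : STree ℚ) (h : NoSatT F T)
    (hg : GapLET F G T) (t : ℚ) (ht : 0 < t) :
    ((treeExp F T (devInd t T.exact) : ℚ) : ℝ)
      ≤ 2 * exp (-2 * (t : ℝ) ^ 2 / (T.nodes * (G : ℝ) ^ 2)) := by
  have hc := treeExp_cast F T (f := devInd t T.exact)
    (g := devInd (t : ℝ) ((T.exact : ℚ) : ℝ)) (fun v => devInd_cast t _ v)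
  rw [← hc]
  have h' := tree_prob_dev_ge_le_exp (realImage F) (G : ℝ) (T.map ((↑) : ℚ → ℝ))
    ((noSatT_cast F T).mpr h) ((gapLET_cast F G T).mpr hg) (t : ℝ) (by exact_mod_cast ht)
  rw [exact_map_cast, nodes_map] at h'
  exact h'

/-! ### Format instances (all orders) -/

namespace Trees

/-- **E2M1 (FP4), any order**: a summation tree with E2M1 leaves and no saturating node deviates
from the exact sum by `≥ t` with probability `≤ 2 exp(−t²/(2m))`, `m` = number of roundings. -/
theorem fp4_tree_prob_dev_ge_le_exp (T : STree ℚ) (hT : LeavesIn FP4.e2m1 T)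
    (h : NoSatT FP4.e2m1 T) (t : ℚ) (ht : 0 < t) :
    ((treeExp FP4.e2m1 T (devInd t T.exact) : ℚ) : ℝ) ≤ 2 * exp (-(t : ℝ) ^ 2 / (2 * T.nodes)) := by
  have := tree_prob_dev_ge_le_exp_rat FP4.e2m1 2 T h (fp4_gapLET_two T hT) t ht
  refine this.trans (le_of_eq ?_)
  congr 1; congr 1; push_cast; ring

/-- **E3M2, any order, all leaves**: under `NoSatT`, `P(|ŝ_T − ∑| ≥ t) ≤ 2 exp(−t²/(8m))`. -/
theorem e3m2_tree_prob_dev_ge_le_exp (T : STree ℚ) (h : NoSatT Formats.e3m2 T) (t : ℚ)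
    (ht : 0 < t) :
    ((treeExp Formats.e3m2 T (devInd t T.exact) : ℚ) : ℝ) ≤ 2 * exp (-(t : ℝ) ^ 2 / (8 * T.nodes)) := by
  have := tree_prob_dev_ge_le_exp_rat Formats.e3m2 4 T h
    (gapLET_of_succ Formats.e3m2_nonempty (G := 4) (by norm_num) Formats.e3m2_succ T) t ht
  refine this.trans (le_of_eq ?_)
  congr 1; congr 1; push_cast; ring

/-- **E2M3, any order, all leaves**: under `NoSatT`, `P(|ŝ_T − ∑| ≥ t) ≤ 2 exp(−8t²/m)`. -/
theorem e2m3_tree_prob_dev_ge_le_exp (T : STree ℚ) (h : NoSatT Formats.e2m3 T) (t : ℚ)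
    (ht : 0 < t) :
    ((treeExp Formats.e2m3 T (devInd t T.exact) : ℚ) : ℝ) ≤ 2 * exp (-(8 * (t : ℝ) ^ 2) / T.nodes) := by
  have := tree_prob_dev_ge_le_exp_rat Formats.e2m3 (1/2) T h
    (gapLET_of_succ Formats.e2m3_nonempty (G := 1/2) (by norm_num) Formats.e2m3_succ T) t ht
  refine this.trans (le_of_eq ?_)
  congr 1; congr 1; push_cast; ring

/-- **E4M3, any order, all leaves**: under `NoSatT`, `P(|ŝ_T − ∑| ≥ t) ≤ 2 exp(−t²/(512m))`. -/
theorem e4m3_tree_prob_dev_ge_le_exp (T : STree ℚ) (h : NoSatT Formats.e4m3 T) (t : ℚ)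
    (ht : 0 < t) :
    ((treeExp Formats.e4m3 T (devInd t T.exact) : ℚ) : ℝ)
      ≤ 2 * exp (-(t : ℝ) ^ 2 / (512 * T.nodes)) := by
  have := tree_prob_dev_ge_le_exp_rat Formats.e4m3 32 T h
    (gapLET_of_succ Formats.e4m3_nonempty (G := 32) (by norm_num) Formats.e4m3_succ T) t ht
  refine this.trans (le_of_eq ?_)
  congr 1; congr 1; push_cast; ring

/-- **E5M2 (finite values), any order, all leaves**: under `NoSatT`,
`P(|ŝ_T − ∑| ≥ t) ≤ 2 exp(−t²/(2²⁵ m))`. -/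
theorem e5m2_tree_prob_dev_ge_le_exp (T : STree ℚ) (h : NoSatT Formats.e5m2 T) (t : ℚ)
    (ht : 0 < t) :
    ((treeExp Formats.e5m2 T (devInd t T.exact) : ℚ) : ℝ)
      ≤ 2 * exp (-(t : ℝ) ^ 2 / (33554432 * T.nodes)) := by
  have := tree_prob_dev_ge_le_exp_rat Formats.e5m2 8192 T h
    (gapLET_of_succ Formats.e5m2_nonempty (G := 8192) (by norm_num) Formats.e5m2_succ T) t ht
  refine this.trans (le_of_eq ?_)
  congr 1; congr 1; push_cast; ring

end Trees

end Summit.Ventures.CertifiedArithmetic.LowPrec.SR
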